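import Summits.NavierStokesRegularity.NavierStokesRegularity.Theses.HubbleDynamo
import Summits.NavierStokesRegularity.NavierStokesRegularity.Theorems.HubbleDynamoBackusRungIdentities

/-!
# Backus bound in Hubble flow (`BackusRung`, route HubbleDynamo, item stmt-NavierStokesRegularity-1939)

The kinematic induction operator `L_V = νΔ + curl((U + a y) × ·)` in the Hubble flow
`V = U + a y` (`div U = 0`, `sup |U| ≤ C₀`, `‖∇U‖` bounded) has no non-decaying normal mode when
`C₀² < 2aν`: if `γ b = νΔb + curl(V × b)` with `γ ≥ 0`, `b` smooth and divergence free,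
`b, ∇b, |y| b ∈ L²`, then `b = 0` (Backus 1958; in Navier–Stokes units this is Leray's
small-constant regime `R_m = C₀²/(aν) < 2`).

Proof (energy estimate): pair the equation with `b` and integrate over `ℝ³`. Pointwise
`curl(V × b) = −2a b + (b·∇)U − (U·∇)b − a (y·∇)b`; the identities of
`HubbleDynamoBackusRungIdentities` give
`γ‖b‖² = −ν ∑ⱼ‖∂ⱼb‖² − ∫ ∑ⱼ bⱼ ⟪∂ⱼ b, U⟫ − (a/2)‖b‖²`, and Cauchy–Schwarz/Young bounds the
stretching term by `ν ∑ⱼ‖∂ⱼ b‖² + (C₀²/4ν)‖b‖²`, whence `γ‖b‖² ≤ (C₀²/(4ν) − a/2)‖b‖² < 0`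
unless `‖b‖₂ = 0`; continuity gives `b = 0`.

## References
* G. Backus, *A class of self-sustaining dissipative spherical dynamos*, Ann. Phys. 4 (1958).
* J. Leray, Acta Math. 63 (1934), §20.
-/

noncomputable section

open MeasureTheory Filter Topology WithLp
open scoped RealInnerProductSpace

-- tree namespace `Summit.<S>.<S>.Theorems` (summit = sub-problem), as in every Theorems file
set_option linter.dupNamespace false

namespace Summit.NavierStokesRegularity.NavierStokesRegularity.Theorems

open Literature.Analysis.FluidPDE

/-! ### The item -/

/-- **`BackusRung`** (item stmt-NavierStokesRegularity-1939, route HubbleDynamo; Backus 1958 /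
Leray's constant): in the Hubble flow `V = U + a y` with `div U = 0`, `sup |U| ≤ C₀`,
`C₀² < 2aν`, the induction operator `νΔ + curl(V × ·)` has no non-decaying normal mode among
smooth divergence-free fields with `b, ∇b, |y| b ∈ L²`: `γ b = νΔb + curl(V × b)` with `γ ≥ 0`
forces `b = 0`. Proof: the energy identity
`γ‖b‖² = −ν‖∇b‖² − ∫ U·(b·∇)b − (a/2)‖b‖² ≤ (C₀²/(4ν) − a/2)‖b‖²`. -/
theorem hubbleDynamo_backusRung_proof :
    Summit.NavierStokesRegularity.NavierStokesRegularity.Theses.HubbleDynamo.BackusRung := by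
  intro ν a C₀ γ hν ha hC hγ U b hU hdivU hUb hDUb hb hdivb hbL2 hDbL2 hyb heq
  obtain ⟨C₁, hC₁⟩ := hDUb
  -- smoothness bookkeeping
  have hU1 : ContDiff ℝ 1 U := hU.of_le (by exact_mod_cast le_top)
  have hb2 : ContDiff ℝ 2 b := hb.of_le (by exact WithTop.coe_le_coe.mpr le_top)
  have hb1 : ContDiff ℝ 1 b := hb2.of_le one_le_two
  have hUd : Differentiable ℝ U := hU1.differentiable one_ne_zero
  have hbd : Differentiable ℝ b := hb1.differentiable one_ne_zero
  have hbc : Continuous b := hb1.continuous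
  have hUc : Continuous U := hU1.continuous
  have hDbc : ∀ j, Continuous fun y => fderiv ℝ b y (EuclideanSpace.single j 1) := fun j =>
    (hb1.continuous_fderiv one_ne_zero).clm_apply continuous_const
  have hDUc : ∀ j, Continuous fun y => fderiv ℝ U y (EuclideanSpace.single j 1) := fun j =>
    (hU1.continuous_fderiv one_ne_zero).clm_apply continuous_const
  have hbjc : ∀ j, Continuous fun y => b y j := fun j =>
    (EuclideanSpace.proj (𝕜 := ℝ) j).continuous.comp hbc
  have hUjc : ∀ j, Continuous fun y => U y j := fun j =>
    (EuclideanSpace.proj (𝕜 := ℝ) j).continuous.comp hUc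
  have hyjc : ∀ j, Continuous fun y : EuclideanSpace ℝ (Fin 3) => y j := fun j =>
    (EuclideanSpace.proj (𝕜 := ℝ) j).continuous
  have hC0 : 0 ≤ C₀ := (norm_nonneg _).trans (hUb 0)
  -- the divergence conditions in coordinates
  have hdivU' : ∀ y, ∑ j, fderiv ℝ U y (EuclideanSpace.single j 1) j = 0 := fun y =>
    (backus_divergence_eq_sum U y).symm.trans (hdivU y)
  have hdivb' : ∀ y, ∑ j, fderiv ℝ b y (EuclideanSpace.single j 1) j = 0 := fun y =>
    (backus_divergence_eq_sum b y).symm.trans (hdivb y)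
  -- integrable dominators built from `b, ∇b, |y| b ∈ L²`
  have hP : Integrable fun y => ‖b y‖ ^ 2 := hbL2.integrable_norm_pow two_ne_zero
  have hbn : MemLp (fun y => ‖b y‖) 2 volume := hbL2.norm
  have hDbn : MemLp (fun y => ‖fderiv ℝ b y‖) 2 volume := hDbL2.norm
  have hybn : MemLp (fun y => ‖y‖ * ‖b y‖) 2 volume := by
    refine (memLp_two_iff_integrable_sq (f := fun y : EuclideanSpace ℝ (Fin 3) => ‖y‖ * ‖b y‖)
      (continuous_norm.mul hbc.norm).aestronglyMeasurable).2 ?_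
    simpa only [mul_pow] using hyb
  have hD2 : Integrable fun y => ‖fderiv ℝ b y‖ * ‖fderiv ℝ b y‖ := hDbn.integrable_mul hDbn
  have hD3 : Integrable fun y => ‖b y‖ * ‖fderiv ℝ b y‖ := hbn.integrable_mul hDbn
  have hD4 : Integrable fun y => ‖y‖ * ‖b y‖ * ‖fderiv ℝ b y‖ := hybn.integrable_mul hDbn
  have hD5 : Integrable fun y => ‖y‖ * ‖b y‖ * ‖b y‖ := hybn.integrable_mul hbn
  -- the dissipation density
  have hS : Integrable fun y => ∑ j, ‖fderiv ℝ b y (EuclideanSpace.single j 1)‖ ^ 2 := by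
    refine integrable_finsetSum _ fun j _ => ?_
    refine backus_integrable_of_bound ((hDbc j).norm.pow 2) hD2 fun y => ?_
    rw [Real.norm_of_nonneg (sq_nonneg _), sq]
    exact mul_le_mul (backus_norm_apply_single_le _ _) (backus_norm_apply_single_le _ _)
      (norm_nonneg _) (norm_nonneg _)
  -- the four first-order pairings, term by term
  have hT1 : ∀ j, Integrable fun y => b y j * ⟪b y, fderiv ℝ U y (EuclideanSpace.single j 1)⟫ := by
    intro j
    refine backus_integrable_of_bound ((hbjc j).mul (hbc.inner (hDUc j))) (hP.const_mul C₁)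
      fun y => ?_
    rw [norm_mul]
    calc ‖b y j‖ * ‖⟪b y, fderiv ℝ U y (EuclideanSpace.single j 1)⟫‖
        ≤ ‖b y‖ * (‖b y‖ * ‖fderiv ℝ U y (EuclideanSpace.single j 1)‖) :=
          mul_le_mul (PiLp.norm_apply_le _ _) (norm_inner_le_norm _ _)
            (norm_nonneg _) (norm_nonneg _)
      _ ≤ ‖b y‖ * (‖b y‖ * C₁) := by
          gcongr
          exact (backus_norm_apply_single_le _ _).trans (hC₁ y)
      _ = C₁ * ‖b y‖ ^ 2 := by ring
  have hT3 : ∀ j, Integrable fun y => b y j * ⟪fderiv ℝ b y (EuclideanSpace.single j 1), U y⟫ := by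
    intro j
    refine backus_integrable_of_bound ((hbjc j).mul ((hDbc j).inner hUc)) (hD3.const_mul C₀)
      fun y => ?_
    rw [norm_mul]
    calc ‖b y j‖ * ‖⟪fderiv ℝ b y (EuclideanSpace.single j 1), U y⟫‖
        ≤ ‖b y‖ * (‖fderiv ℝ b y (EuclideanSpace.single j 1)‖ * ‖U y‖) :=
          mul_le_mul (PiLp.norm_apply_le _ _) (norm_inner_le_norm _ _)
            (norm_nonneg _) (norm_nonneg _)
      _ ≤ ‖b y‖ * (‖fderiv ℝ b y‖ * C₀) := by
          gcongr
          · exact backus_norm_apply_single_le _ _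
          · exact hUb y
      _ = C₀ * (‖b y‖ * ‖fderiv ℝ b y‖) := by ring
  have hT5 : ∀ j, Integrable fun y => U y j * ⟪b y, fderiv ℝ b y (EuclideanSpace.single j 1)⟫ := by
    intro j
    refine backus_integrable_of_bound ((hUjc j).mul (hbc.inner (hDbc j))) (hD3.const_mul C₀)
      fun y => ?_
    rw [norm_mul]
    calc ‖U y j‖ * ‖⟪b y, fderiv ℝ b y (EuclideanSpace.single j 1)⟫‖
        ≤ C₀ * (‖b y‖ * ‖fderiv ℝ b y (EuclideanSpace.single j 1)‖) :=
          mul_le_mul ((PiLp.norm_apply_le _ _).trans (hUb y)) (norm_inner_le_norm _ _)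
            (norm_nonneg _) hC0
      _ ≤ C₀ * (‖b y‖ * ‖fderiv ℝ b y‖) := by
          gcongr
          exact backus_norm_apply_single_le _ _
  have hT9 : ∀ j, Integrable fun y => y j * ⟪b y, fderiv ℝ b y (EuclideanSpace.single j 1)⟫ := by
    intro j
    refine backus_integrable_of_bound ((hyjc j).mul (hbc.inner (hDbc j))) hD4 fun y => ?_
    rw [norm_mul, mul_assoc]
    calc ‖y j‖ * ‖⟪b y, fderiv ℝ b y (EuclideanSpace.single j 1)⟫‖
        ≤ ‖y‖ * (‖b y‖ * ‖fderiv ℝ b y (EuclideanSpace.single j 1)‖) :=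
          mul_le_mul (PiLp.norm_apply_le _ _) (norm_inner_le_norm _ _)
            (norm_nonneg _) (norm_nonneg _)
      _ ≤ ‖y‖ * (‖b y‖ * ‖fderiv ℝ b y‖) := by
          gcongr
          exact backus_norm_apply_single_le _ _
  have hIA : Integrable fun y => ∑ j, b y j * ⟪b y, fderiv ℝ U y (EuclideanSpace.single j 1)⟫ :=
    integrable_finsetSum _ fun j _ => hT1 j
  have hIA' : Integrable fun y => ∑ j, b y j * ⟪fderiv ℝ b y (EuclideanSpace.single j 1), U y⟫ :=
    integrable_finsetSum _ fun j _ => hT3 j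
  have hIB : Integrable fun y => ∑ j, U y j * ⟪b y, fderiv ℝ b y (EuclideanSpace.single j 1)⟫ :=
    integrable_finsetSum _ fun j _ => hT5 j
  have hIC : Integrable fun y => ∑ j, y j * ⟪b y, fderiv ℝ b y (EuclideanSpace.single j 1)⟫ :=
    integrable_finsetSum _ fun j _ => hT9 j
  -- the curl pairing, pointwise
  have hK : ∀ y, ⟪b y, curl (fun z => cross (U z + a • z) (b z)) y⟫ =
      -(2 * a) * ‖b y‖ ^ 2 + ∑ j, b y j * ⟪b y, fderiv ℝ U y (EuclideanSpace.single j 1)⟫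
        - ∑ j, U y j * ⟪b y, fderiv ℝ b y (EuclideanSpace.single j 1)⟫ - a * ∑ j, y j * ⟪b y,
            fderiv ℝ b y (EuclideanSpace.single j 1)⟫ := by
    intro y
    rw [backus_curl_cross_expand (hUd y) (hbd y) (hdivU' y) (hdivb' y)]
    simp only [inner_sub_right, inner_add_right, inner_smul_right, inner_sum,
      real_inner_self_eq_norm_sq]
  have hK_int : Integrable fun y => ⟪b y, curl (fun z => cross (U z + a • z) (b z)) y⟫ := by
    simp_rw [hK]
    exact (((hP.const_mul _).add hIA).sub hIB).sub (hIC.const_mul a)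
  -- the Laplacian pairing, pointwise from the equation
  have hLpt : ∀ y, ⟪b y, Laplacian.laplacian b y⟫ =
      ν⁻¹ * (γ * ‖b y‖ ^ 2 - ⟪b y, curl (fun z => cross (U z + a • z) (b z)) y⟫) := by
    intro y
    have h1 : ν • Laplacian.laplacian b y =
        γ • b y - curl (fun z => cross (U z + a • z) (b z)) y := by
      rw [heq y, add_sub_cancel_right]
    have h2 : Laplacian.laplacian b y =
        ν⁻¹ • (γ • b y - curl (fun z => cross (U z + a • z) (b z)) y) := by
      rw [← h1, smul_smul, inv_mul_cancel₀ hν.ne', one_smul]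
    rw [h2, inner_smul_right, inner_sub_right, inner_smul_right, real_inner_self_eq_norm_sq]
  have hL_int : Integrable fun y => ⟪b y, Laplacian.laplacian b y⟫ := by
    simp_rw [hLpt]
    exact ((hP.const_mul γ).sub hK_int).const_mul ν⁻¹
  -- the integrated equation
  have hEq : γ * ∫ y, ‖b y‖ ^ 2 = ν * (∫ y, ⟪b y, Laplacian.laplacian b y⟫)
      + ∫ y, ⟪b y, curl (fun z => cross (U z + a • z) (b z)) y⟫ := by
    have hpt : ∀ y, γ * ‖b y‖ ^ 2 = ν * ⟪b y, Laplacian.laplacian b y⟫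
        + ⟪b y, curl (fun z => cross (U z + a • z) (b z)) y⟫ := by
      intro y
      have h := congrArg (fun w => ⟪b y, w⟫) (heq y)
      simpa only [inner_add_right, inner_smul_right, real_inner_self_eq_norm_sq] using h
    rw [← integral_const_mul, ← integral_const_mul, ← integral_add (hL_int.const_mul ν) hK_int]
    exact integral_congr_ae (ae_of_all _ hpt)
  -- the four energy identities
  have hW4 := backus_integral_laplacian hb2 hD3 hS hL_int
  have hW1 := backus_integral_stretch hU1 hb1 hdivb' hUb hT1 hT3 hP hD3
  have hW2 := backus_integral_transport hU1 hb1 hdivU' hUb hC₁ hT5 hP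
  have hW3 := backus_integral_hubble hb1 hT9 hP hD5
  have hKint : ∫ y, ⟪b y, curl (fun z => cross (U z + a • z) (b z)) y⟫ =
      -(2 * a) * (∫ y, ‖b y‖ ^ 2) + (∫ y, ∑ j, b y j * ⟪b y, fderiv ℝ U y (EuclideanSpace.single j
          1)⟫)
        - (∫ y, ∑ j, U y j * ⟪b y, fderiv ℝ b y (EuclideanSpace.single j 1)⟫)
        - a * ∫ y, ∑ j, y j * ⟪b y, fderiv ℝ b y (EuclideanSpace.single j 1)⟫ := by
    simp_rw [hK]
    have i1 : Integrable fun y => -(2 * a) * ‖b y‖ ^ 2 := hP.const_mul _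
    have i2 : Integrable fun y => -(2 * a) * ‖b y‖ ^ 2
        + ∑ j, b y j * ⟪b y, fderiv ℝ U y (EuclideanSpace.single j 1)⟫ := i1.add hIA
    have i3 : Integrable fun y => -(2 * a) * ‖b y‖ ^ 2
        + ∑ j, b y j * ⟪b y, fderiv ℝ U y (EuclideanSpace.single j 1)⟫ - ∑ j, U y j * ⟪b y, fderiv
            ℝ b y (EuclideanSpace.single j 1)⟫ :=
      i2.sub hIB
    have i4 : Integrable fun y => a * ∑ j, y j * ⟪b y, fderiv ℝ b y (EuclideanSpace.single j 1)⟫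
        := hIC.const_mul a
    rw [integral_sub i3 i4, integral_sub i2 hIB, integral_add i1 hIA, integral_const_mul,
      integral_const_mul]
  -- the stretching term is controlled by dissipation plus `C₀²/(4ν)` of the energy
  have hA'bd : -∫ y, ∑ j, b y j * ⟪fderiv ℝ b y (EuclideanSpace.single j 1), U y⟫ ≤
      ν * (∫ y, ∑ j, ‖fderiv ℝ b y (EuclideanSpace.single j 1)‖ ^ 2) + C₀ ^ 2 / (4 * ν) * ∫ y, ‖b
          y‖ ^ 2 := by
    rw [← integral_neg, ← integral_const_mul, ← integral_const_mul,
      ← integral_add (hS.const_mul ν) (hP.const_mul _)]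
    refine integral_mono hIA'.neg ((hS.const_mul ν).add (hP.const_mul _)) fun y => ?_
    exact (neg_le_abs _).trans
      (backus_stretching_bound hν hC0 (b y) (U y) (fun j => fderiv ℝ b y (EuclideanSpace.single j
          1)) (hUb y))
  -- conclusion: the energy vanishes
  have hXnn : 0 ≤ ∫ y, ‖b y‖ ^ 2 := integral_nonneg fun y => sq_nonneg _
  have hSnn : 0 ≤ ∫ y, ∑ j, ‖fderiv ℝ b y (EuclideanSpace.single j 1)‖ ^ 2 :=
    integral_nonneg fun y => Finset.sum_nonneg fun j _ => sq_nonneg _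
  have hc : C₀ ^ 2 / (4 * ν) < a / 2 := by
    rw [div_lt_div_iff₀ (by positivity) two_pos]
    nlinarith
  have hmain : γ * ∫ y, ‖b y‖ ^ 2 ≤ (C₀ ^ 2 / (4 * ν) - a / 2) * ∫ y, ‖b y‖ ^ 2 := by
    rw [hW4, hKint, hW1, hW2, hW3] at hEq
    nlinarith [hEq, hA'bd]
  have hX0 : ∫ y, ‖b y‖ ^ 2 = 0 := by
    refine le_antisymm ?_ hXnn
    nlinarith [hmain, hXnn, hc, hγ]
  have hae : (fun y => ‖b y‖ ^ 2) =ᵐ[volume] 0 :=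
    (integral_eq_zero_iff_of_nonneg (fun y => sq_nonneg _) hP).1 hX0
  have hfun : (fun y => ‖b y‖ ^ 2) = 0 :=
    MeasureTheory.Measure.eq_of_ae_eq hae (hbc.norm.pow 2) continuous_const
  funext y
  have hy := congrFun hfun y
  simpa using hy

end Summit.NavierStokesRegularity.NavierStokesRegularity.Theorems
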